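import Mathlib
import Summits.NavierStokesRegularity.NavierStokesRegularity.Theorems.TypeIQuarterGateScarEnvelopeTypeIZoomDictionaryDefs
import Summits.NavierStokesRegularity.NavierStokesRegularity.Theorems.TypeIQuarterGateScarEnvelopeTypeIFatKill
import Summits.NavierStokesRegularity.NavierStokesRegularity.Theorems.TypeIQuarterGateScarEnvelopeTypeIBudgetViolators
import Summits.NavierStokesRegularity.NavierStokesRegularity.Theorems.TypeIQuarterGateScarEnvelopeTypeIOfNoTwinScarObject
import Summits.NavierStokesRegularity.NavierStokesRegularity.Theorems.TypeIQuarterGateQuarterLawTypeIGlue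
import Summits.NavierStokesRegularity.NavierStokesRegularity.Theorems.TypeIQuarterGateEnvelopeQuarterLaw
import Summits.NavierStokesRegularity.NavierStokesRegularity.Theorems.TypeIQuarterGateScarEnvelopeTypeINearOneRateDss
import Literature.Analysis.FluidPDE.AncientAxisymmetricTypeILiouville
import Summits.NavierStokesRegularity.NavierStokesRegularity.Theorems.TypeIQuarterGateScarEnvelopeTypeIZoomDictionaryUnitInputs
import Summits.NavierStokesRegularity.NavierStokesRegularity.Theorems.TypeIQuarterGateScarEnvelopeTypeISatelliteTowerDefs
import Summits.NavierStokesRegularity.NavierStokesRegularity.Theorems.TypeIQuarterGateScarEnvelopeTypeISatelliteTowerObjects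
import Summits.NavierStokesRegularity.NavierStokesRegularity.Theorems.TypeIQuarterGateScarEnvelopeTypeISatelliteTowerClosure
import Summits.NavierStokesRegularity.NavierStokesRegularity.Theorems.TypeIQuarterGateScarEnvelopeTypeISatelliteTowerCensus

/-!
# Part K12: the two EXCLUSIONS that would close 23843 through the census (typed, OPEN) and the proved assembly

Part K12 of the plate (v5): `OneScarLeaf M` / `InfiniteDescent M` (typed, OPEN), `oneScarLeaf_of_tameNode`, the PROVED assemblies `scarEnvelopeTypeI_of_noTame_noDescent` / `scarEnvelopeTypeI_of_exclusions : (∀ M, ¬ OneScarLeaf M) → (∀ M, ¬ InfiniteDescent M) → ScarEnvelopeTypeI`, `noTame_noDescent_of_noTwinScar` (scar_zoom's deciding stub factors through the census) and `infiniteDescent_not_nearOneDss` (the DSS-wall rung on the infinite branch).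

PROVENANCE: declaration texts VERBATIM from the HOME plates of the instrument seat nsreg-p3 (g24/g25, cell
`pub/ns-regularity-ideate`): `round-31/Tangent31prep.lean` v5 (sha16 `e5b8668e3a090216`; = ROUND-30 plate v10 + Part K) and,
for Part L, `round-32/Tangent32prep.lean` v6 (sha16 `6123f27718636121`);
the author cannot write under `Theorems/` (`perm.theorems-prover-only`); landed by the
LEAD-lineage prover ns-sz-p1 g5 on director-ns DIRECTOR-NS #218 (2), split into ≤ 400-line modules (the
plate's `def`s gathered in `TypeIQuarterGateScarEnvelopeTypeIZoomDictionaryDefs`), namespace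
`Summit.NavierStokesRegularity.NavierStokesRegularity.Cruxes.ScarEnvelopeTypeI.ZoomDictionary` (the plate's `NsregP3.R30P`), `E3` spelled out, one-line docstrings
added where the plate had none.  `--supports stmt-NavierStokesRegularity-23843 --as helper`.

HONEST FRAMING: dictionary / census TOOLING for the crux `TypeIQuarterGate.ScarEnvelopeTypeI` (item 23843):
equivalences and normal forms, kernel-checked; NO open statement is proved — 23843, its parent
`QuarterLawTypeI` (23726), the route and Navier–Stokes regularity are OPEN; hard core evaded: none.
-/

-- the summit-side namespace repeats a component by design (single-conjunct summit, D-0017)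
set_option linter.dupNamespace false

open MeasureTheory Set Metric Filter Topology
open scoped ENNReal

namespace Summit.NavierStokesRegularity.NavierStokesRegularity.Cruxes.ScarEnvelopeTypeI.ZoomDictionary

variable {u : ℝ → (EuclideanSpace ℝ (Fin 3)) → (EuclideanSpace ℝ (Fin 3))} {a : (EuclideanSpace ℝ (Fin 3))} {ν T : ℝ}

section Tower

open Literature.Analysis.FluidPDE
variable {U : ℝ → (EuclideanSpace ℝ (Fin 3)) → (EuclideanSpace ℝ (Fin 3))} {P : ℝ → (EuclideanSpace ℝ (Fin 3)) → ℝ} {y' : (EuclideanSpace ℝ (Fin 3))} {ν : ℝ}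
open Summit.NavierStokesRegularity.NavierStokesRegularity.Cruxes.ScarEnvelopeTypeI.ScarZoom
  (CruxHypotheses ScarViolators TwinScarObject singularAt_of_isBackwardSingularPoint
    exists_localEnergy_of_typeIBound) in

/-! ### K12. The two EXCLUSIONS that would close 23843 through the census (typed, OPEN), the
assembly (proved), and how scar_zoom's deciding stub factors through them

`(F)` the finite branch ends at a TAME node, whose tangent flows are ONE-SCAR LEAVES
(`oneScarLeaf_of_tameNode`); `(I)` the infinite branch is an `InfiniteDescent`.  Hence
`(∀ M, no tame rooted node) → (∀ M, ¬ InfiniteDescent M) → ScarEnvelopeTypeI` (proved), the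
ONE-SCAR LIOUVILLE statement `∀ M, ¬ OneScarLeaf M` implies the first exclusion, and scar_zoom's
stub `∀ M v, ¬ TwinScarObject M v` implies both (every rooted node normalises to a twin-scar
object, K11).  The exclusions themselves are NOT proved: 23843 / 23726 / N0 stay open. -/

/-- **Tangent flows exist at every final-time point of a tower object** (compactness I1, tree
`SuitableCompactness_holds` via `i1_of_suitableCompactness`). -/
theorem exists_tangentU_of_towerObj {M : ℝ} (h : TowerObj M U P) (y' : (EuclideanSpace ℝ (Fin 3))) :
    ∃ (L : ℕ → ℝ) (Ū : ℝ → (EuclideanSpace ℝ (Fin 3)) → (EuclideanSpace ℝ (Fin 3))), TangentU U P y' 0 L Ū := by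
  obtain ⟨-, -, hZ, hB⟩ := h.inputs y'
  obtain ⟨φ, -, ū, hū⟩ := i1_of_suitableCompactness hZ hB (fun k => 1 / ((k : ℝ) + 1))
    (fun k => by positivity) tendsto_one_div_add_atTop_nhds_zero_nat
  have hū' : TangentU (tshift U) (tshift P) y' 1 (fun k => c₀ * (1 / ((φ k : ℝ) + 1))) ū := hū
  exact ⟨_, ū, tangentU_tshift_iff.1 hū'⟩

/-- **A tame rooted node produces a one-scar leaf of the same rate** (some tangent flow exists,
it is one-scar by `oneScar_of_tameNode`, and it has an `ABTower` representative, `abTower_closed`). -/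
theorem oneScarLeaf_of_tameNode {M : ℝ} {n : TNode} (hn : RootedNode M n) (ht : TameNode n) :
    OneScarLeaf M := by
  obtain ⟨L, Ū, hŪ⟩ := exists_tangentU_of_towerObj (towerObj_of_abTower hn.1.1) n.y
  obtain ⟨h0, hreg⟩ := oneScar_of_tameNode hn.1 ht hŪ
  obtain ⟨U', P', H', hAB', hae⟩ := abTower_closed hn.1.1 hŪ
  exact ⟨U', P', H', hAB', fun h => h0 ((regPt_iff_of_ae_eq_of_norm_lt_one hae (by simp)).2 h),
    fun y hy0 hy1 => (regPt_iff_of_ae_eq_of_norm_lt_one hae hy1).1 (hreg y hy0 hy1)⟩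

open Summit.NavierStokesRegularity.NavierStokesRegularity.Cruxes.ScarEnvelopeTypeI in
/-- **ASSEMBLY THROUGH THE CENSUS (proved): no tame rooted node + no infinite rooted descent ⇒ the
crux item 23843.**  (The two hypotheses are OPEN.) -/
theorem scarEnvelopeTypeI_of_noTame_noDescent
    (hF : ∀ (M : ℝ) (n : TNode), RootedNode M n → ¬ TameNode n)
    (hI : ∀ M : ℝ, ¬ InfiniteDescent M) :
    Summit.NavierStokesRegularity.NavierStokesRegularity.Theses.TypeIQuarterGate.ScarEnvelopeTypeI := by
  by_contra h
  obtain ⟨M, c₁, n₀, -, -, -, -, -, hcensus⟩ := census_of_not_scarEnvelopeTypeI₂ h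
  rcases hcensus with ⟨c, k, -, -, hch, htame⟩ | ⟨c, -, hc⟩
  · exact hF M (c k) (hch k le_rfl) htame
  · exact hI M ⟨c, hc⟩

open Summit.NavierStokesRegularity.NavierStokesRegularity.Cruxes.ScarEnvelopeTypeI in
/-- **ASSEMBLY, leaf form (proved): ONE-SCAR LIOUVILLE + NO INFINITE DESCENT ⇒ 23843.** -/
theorem scarEnvelopeTypeI_of_exclusions (hF : ∀ M : ℝ, ¬ OneScarLeaf M)
    (hI : ∀ M : ℝ, ¬ InfiniteDescent M) :
    Summit.NavierStokesRegularity.NavierStokesRegularity.Theses.TypeIQuarterGate.ScarEnvelopeTypeI :=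
  scarEnvelopeTypeI_of_noTame_noDescent (fun M _ hn ht => hF M (oneScarLeaf_of_tameNode hn ht)) hI

open Summit.NavierStokesRegularity.NavierStokesRegularity.Cruxes.ScarEnvelopeTypeI in
/-- **scar_zoom's deciding stub factors through the census**: «no twin-scar object of any rate»
implies both exclusions (every rooted node normalises to a twin-scar object, `twinScar_of_rootedNode`). -/
theorem noTame_noDescent_of_noTwinScar (h : ∀ (M : ℝ) (v : ℝ → (EuclideanSpace ℝ (Fin 3)) → (EuclideanSpace ℝ (Fin 3))), ¬ ScarZoom.TwinScarObject M v) :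
    (∀ (M : ℝ) (n : TNode), RootedNode M n → ¬ TameNode n) ∧ ∀ M : ℝ, ¬ InfiniteDescent M := by
  refine ⟨fun M n hn _ => ?_, fun M ⟨c, hc⟩ => ?_⟩
  · obtain ⟨n', -, -, hTS, -⟩ := twinScar_of_rootedNode hn
    exact h M n'.U hTS
  · obtain ⟨n', -, -, hTS, -⟩ := twinScar_of_rootedNode (hc 0).1
    exact h M n'.U hTS

/-- **The DSS wall on the infinite branch** (informational): along an infinite rooted descent no
level is `c`-DSS about any centre for `1 < c < c₁(M)`. -/
theorem infiniteDescent_not_nearOneDss {M : ℝ} {c : ℕ → TNode}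
    (hc : ∀ k, RootedNode M (c k) ∧ ¬ TameNode (c k) ∧ Descends (c k) (c (k + 1))) :
    ∃ c₁ : ℝ, 1 < c₁ ∧ ∀ k, ∀ d : ℝ, 1 < d → d < c₁ → ∀ x₀ : (EuclideanSpace ℝ (Fin 3)),
      ¬ IsDiscretelySelfSimilar d (fun t x => (c k).U t (x + x₀)) := by
  obtain ⟨c₁, hc₁, h⟩ := abTower_not_nearOneDss M
  exact ⟨c₁, hc₁, fun k d h1 h2 x₀ =>
    h d h1 h2 (c k).U (c k).P (c k).H (hc k).1.1.1 (hc k).1.2 x₀⟩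

end Tower

end Summit.NavierStokesRegularity.NavierStokesRegularity.Cruxes.ScarEnvelopeTypeI.ZoomDictionary
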